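import Summits.Parity.GeneralizedHardyLittlewood.Theorems.GreenTaoLevelTwoMNTwoFourierReplace

/-!
# Route `GreenTaoLevelTwo`, crux `MNTwo` (stmt-Parity-21276), line `birth`, stub `stub_mnVertical`:
# Fourier replacement of the sixteenth cutoff on the box of differences (GT 2008b §10, Lemma 24)

Step 6 of the remaining Lemma-24 assembly for `stub_mnVertical` (B. Green, T. Tao, *Quadratic
uniformity of the Möbius function*, Ann. Inst. Fourier 58 (2008) = arXiv:math/0606087, §10: "The
treatment of the last term … requires a Fourier expansion (Lemma A.7) … by the pigeonhole principle
there is a frequency `ξ` such that …").  Def-free four-variable form of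
`…MNTwoFourierReplace.exists_large_character` on the box `A × B × A × B` of differences
`(l₁, m₁, l₂, m₂)`: the weight `W` (the other fifteen cutoffs and the two box indicators, `|W| ≤ 1`)
multiplies a factor `a` (the sixteenth cutoff) which is `δ`-approximated by `∑_{j<J} c_j e_j` ONLY
WHERE `W ≠ 0` (there the point lies in `B(n₀,3ρ)`), and a unit phase `g`; some `j < J` then has
`(Y − δ(#A)²(#B)²)/(JC) ≤ ‖∑ W e_j g‖`.

* `fourier_replace_box` — the statement just described.

References: [GreenTao2008QuadraticMobius] arXiv:math/0606087 §10 (proof of Lemma 24), Lemma 37.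
-/

noncomputable section

open Finset

namespace Summit.Parity.GeneralizedHardyLittlewood.GreenTaoLevelTwoMNTwoFourierReplaceBox

open Summit.Parity.GeneralizedHardyLittlewood.GreenTaoLevelTwoMNTwoFourierReplace
  (exists_large_character)

/-- **Fourier replacement of one factor in a fourfold weighted sum.**  `A, B` finite sets of
integers, `|W| ≤ 1`, `‖g‖ ≤ 1`, `J ≥ 1`, `‖c_j‖ ≤ C` (`C > 0`), `δ ≥ 0`, and
`‖a − ∑_{j<J} c_j e_j‖ ≤ δ` at every point of `A × B × A × B` where `W ≠ 0`.  If
`Y ≤ ‖∑_{l₁∈A} ∑_{m₁∈B} ∑_{l₂∈A} ∑_{m₂∈B} W·a·g‖` then some `j < J` has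
`(Y − δ(#A)²(#B)²)/(JC) ≤ ‖∑ W·e_j·g‖`.
[cite: GreenTao2008QuadraticMobius, §10 (proof of Lemma 24, the use of Lemma 37)] -/
theorem fourier_replace_box (A B : Finset ℤ) (W : ℤ → ℤ → ℤ → ℤ → ℝ)
    (hW : ∀ l₁ m₁ l₂ m₂, |W l₁ m₁ l₂ m₂| ≤ 1) (a g : ℤ → ℤ → ℤ → ℤ → ℂ)
    (hg : ∀ l₁ m₁ l₂ m₂, ‖g l₁ m₁ l₂ m₂‖ ≤ 1) {J : ℕ} (hJ : 1 ≤ J) (c : ℕ → ℂ) {C δ Y : ℝ}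
    (hc : ∀ j ∈ range J, ‖c j‖ ≤ C) (hC : 0 < C) (hδ : 0 ≤ δ) (e : ℕ → ℤ → ℤ → ℤ → ℤ → ℂ)
    (happrox : ∀ l₁ ∈ A, ∀ m₁ ∈ B, ∀ l₂ ∈ A, ∀ m₂ ∈ B, W l₁ m₁ l₂ m₂ ≠ 0 →
      ‖a l₁ m₁ l₂ m₂ - ∑ j ∈ range J, c j * e j l₁ m₁ l₂ m₂‖ ≤ δ)
    (hY : Y ≤ ‖∑ l₁ ∈ A, ∑ m₁ ∈ B, ∑ l₂ ∈ A, ∑ m₂ ∈ B,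
      (W l₁ m₁ l₂ m₂ : ℂ) * a l₁ m₁ l₂ m₂ * g l₁ m₁ l₂ m₂‖) :
    ∃ j ∈ range J, (Y - δ * (#A : ℝ) ^ 2 * (#B : ℝ) ^ 2) / (J * C) ≤
      ‖∑ l₁ ∈ A, ∑ m₁ ∈ B, ∑ l₂ ∈ A, ∑ m₂ ∈ B,
        (W l₁ m₁ l₂ m₂ : ℂ) * e j l₁ m₁ l₂ m₂ * g l₁ m₁ l₂ m₂‖ := by
  classical
  -- flatten to the product finset
  set s : Finset ((ℤ × ℤ) × (ℤ × ℤ)) := (A ×ˢ B) ×ˢ (A ×ˢ B) with hs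
  have hflat : ∀ F : ℤ → ℤ → ℤ → ℤ → ℂ,
      ∑ i ∈ s, F i.1.1 i.1.2 i.2.1 i.2.2 = ∑ l₁ ∈ A, ∑ m₁ ∈ B, ∑ l₂ ∈ A, ∑ m₂ ∈ B,
        F l₁ m₁ l₂ m₂ := by
    intro F
    simp only [hs, Finset.sum_product]
  -- the modified factor `a'` (equal to its expansion where `W = 0`)
  set W' : (ℤ × ℤ) × (ℤ × ℤ) → ℝ := fun i => W i.1.1 i.1.2 i.2.1 i.2.2 with hW'
  set g' : (ℤ × ℤ) × (ℤ × ℤ) → ℂ := fun i => g i.1.1 i.1.2 i.2.1 i.2.2 with hg'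
  set e' : ℕ → (ℤ × ℤ) × (ℤ × ℤ) → ℂ := fun j i => e j i.1.1 i.1.2 i.2.1 i.2.2 with he'
  set a' : (ℤ × ℤ) × (ℤ × ℤ) → ℂ := fun i =>
    if W' i = 0 then ∑ j ∈ range J, c j * e' j i else a i.1.1 i.1.2 i.2.1 i.2.2 with ha'
  have hWa : ∀ i, (W' i : ℂ) * a' i * g' i =
      (W i.1.1 i.1.2 i.2.1 i.2.2 : ℂ) * a i.1.1 i.1.2 i.2.1 i.2.2 * g i.1.1 i.1.2 i.2.1 i.2.2 := by
    intro i
    by_cases h : W' i = 0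
    · have h' : W i.1.1 i.1.2 i.2.1 i.2.2 = 0 := h
      simp only [hW', h', Complex.ofReal_zero, zero_mul]
    · have ha'i : a' i = a i.1.1 i.1.2 i.2.1 i.2.2 := by simp only [ha', if_neg h]
      rw [ha'i]
  have hY' : Y ≤ ‖∑ i ∈ s, (W' i : ℂ) * a' i * g' i‖ := by
    rw [Finset.sum_congr rfl fun i _ => hWa i,
      hflat (fun l₁ m₁ l₂ m₂ => (W l₁ m₁ l₂ m₂ : ℂ) * a l₁ m₁ l₂ m₂ * g l₁ m₁ l₂ m₂)]
    exact hY
  have happrox' : ∀ i ∈ s, ‖a' i - ∑ j ∈ range J, c j * e' j i‖ ≤ δ := by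
    intro i hi
    by_cases h : W' i = 0
    · simp only [ha', if_pos h, sub_self, norm_zero]; exact hδ
    · simp only [ha', if_neg h, he']
      rw [hs, Finset.mem_product, Finset.mem_product, Finset.mem_product] at hi
      exact happrox _ hi.1.1 _ hi.1.2 _ hi.2.1 _ hi.2.2 h
  obtain ⟨j, hj, hbound⟩ := exists_large_character s W' g' a' (B₀ := 1)
    (fun i _ => hW _ _ _ _) (fun i _ => hg _ _ _ _) hJ c hc hC e' happrox' hY'
  refine ⟨j, hj, ?_⟩
  have hcard : (#s : ℝ) = (#A : ℝ) ^ 2 * (#B : ℝ) ^ 2 := by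
    rw [hs, Finset.card_product, Finset.card_product]
    push_cast; ring
  rw [mul_one, hcard, ← mul_assoc] at hbound
  rw [← hflat (fun l₁ m₁ l₂ m₂ => (W l₁ m₁ l₂ m₂ : ℂ) * e j l₁ m₁ l₂ m₂ * g l₁ m₁ l₂ m₂)]
  exact hbound

end Summit.Parity.GeneralizedHardyLittlewood.GreenTaoLevelTwoMNTwoFourierReplaceBox
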